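import Summits.KontsevichZagierPeriods.KontsevichZagierPeriods.Theorems.LinRedNormalFormArrangementNormalFormStubRebaseSimplePosOneFibreParExchange

/-!
# Stub `stub_rebaseSimplePosOne`, residual hypothesis `Hpar` (crux `ArrangementNormalForm`,
line `janus-bands`, v6.2) — sub-part `ParSplit`

Steps EXCHANGE + SPLIT + PRODUCT of the UNFOLD–EXCHANGE treatment of a THIN parallel band,
uniformly in the silent coordinates `x'` (continuation of sub-part `ParExchange`). INPUT: the
unfolded-and-cycled representation `U'` on
`{(x', t', σ, y) | (x', t', σ) ∈ gDom M₃ (A, Bf), ylo(x') < y < yhi(x')}` with integrand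
`c(x', t') · (y − σ)^{-2}`, `c = (R(x')/s)/(Bf − A)`, the `y`-range NON-PINCHING
(`yhi − ylo ≥ η > 0` on the output rows) and `σ` never in `[ylo, yhi]` (`hlegO`). Then
(`RebasePos.exchange_split`):
* EXCHANGE (rule 3 forwards, `IntegrateOut.newtonLeibniz_pack` with the rational primitive
  `−c/(y − σ)`): `y` is integrated out, leaving `V` on the LITERAL output domain
  `gDom M₃ (A, Bf)` with integrand `c · (1/(ylo − σ) − 1/(yhi − σ))`;
* SPLIT (rule 1b): `V = V₁ + V₂` with `V₁ = V · (yhi − σ)/(yhi − ylo)`, `V₂ = V · (σ − ylo)/(yhi − ylo)`,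
  both multipliers BOUNDED by non-pinching and boundedness (`SeparatePos.mulRep`), so that
  `V₁ = c/(ylo − σ)` and `V₂ = c/(σ − yhi)` converge absolutely (this is exactly the step that
  DIVERGES over a pinching `y`-range, e.g. for `[{0<y<x<1, y+1<t<y+1+x}, 1/(x²(y+1)t)]`);
* PRODUCT: with `Bf − A = ±(t' + κ'(x'))/s`, `κ' = u₀ + s ℓ₂`, both pieces are LITERAL `GG B 2 1`
  data over the base `(x', t')` — base pole `1/(t' + κ')`, fibre `σ` with the `t'`-free letters
  `ylo(x')`, `yhi(x')` and bounds `{A, Bf} = {τ, ℓ₂}` one of which is `t'`-free — and land by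
  `RebasePos.good_product` (one affine pull-back normalising the `τ`-bound to the coordinate
  `t'` itself, rule 2).
Registered as `rebaseSimplePos_exchangeSplit`.

References: M. Kontsevich, D. Zagier, *Periods* (2001), §1.2, rules (1b), (2), (3).
-/

noncomputable section

open Set MeasureTheory MvPolynomial
open Literature.NumberTheory.Transcendental Literature.ModelTheory.ExponentialFields

namespace Summit.KontsevichZagierPeriods.ArrangementNormalForm.JanusBands

namespace RebasePos

open SeparatePos IntegrateOut

section Forms

variable {B : ℕ}

/-- `affB` of a negated form. -/
theorem affB_neg' (c : (Fin B → ℚ) × ℚ) (z : Fin (B + 1 + 1) → ℝ) : affB B 1 (-c) z = -affB B 1 c z := by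
  simp only [affB, Prod.fst_neg, Prod.snd_neg, Pi.neg_apply, Rat.cast_neg, neg_mul, Finset.sum_neg_distrib]
  ring

/-- `affB` of a scalar multiple. -/
theorem affB_smul' (q : ℚ) (c : (Fin B → ℚ) × ℚ) (z : Fin (B + 1 + 1) → ℝ) :
    affB B 1 (q • c) z = (q : ℝ) * affB B 1 c z := by
  simp only [affB, Prod.smul_fst, Prod.smul_snd, Pi.smul_apply, smul_eq_mul, Rat.cast_mul, Finset.mul_sum,
    mul_add]
  ring

end Forms

section ExchangeSplit

variable {B m m₃ : ℕ} (L : Fin m → (Fin B → ℚ) × ℚ) (e : Fin m → ℕ) (p₃ : MvPolynomial (Fin B) ℚ)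
  (ℓ₂ : (Fin B → ℚ) × ℚ) (u : (Fin (B + 1) → ℚ) × ℚ) (M₃ : Fin m₃ → (Fin (B + 1) → ℚ) × ℚ)
  (A Bf : (Fin (B + 1) → ℚ) × ℚ) (ylo yhi : (Fin B → ℚ) × ℚ)

/-- **EXCHANGE + SPLIT + PRODUCT.** See the module docstring. -/
theorem exchange_split (U' : KZ.IntegralRep (B + 1 + 1 + 1))
    (hU'd : U'.domain = {w | (Fin.init w : Fin (B + 1 + 1) → ℝ) ∈ gDom B 1 m₃ M₃ (fun _ => Sum.inr A) (fun _ => Sum.inr Bf) ∧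
        affB B 1 ylo (Fin.init w) < w (Fin.last (B + 1 + 1)) ∧
        w (Fin.last (B + 1 + 1)) < affB B 1 yhi (Fin.init w)})
    (hU'i : EqOn U'.integrand (fun w => MvPolynomial.aeval (fun i => Fin.init w (Fin.castAdd 1 (Fin.castSucc i))) p₃ /
        (∏ j, (affB B 1 (L j) (Fin.init w)) ^ e j) / (u.1 (Fin.last B) : ℝ) /
        (affF B 1 Bf (Fin.init w) - affF B 1 A (Fin.init w)) /
        (w (Fin.last (B + 1 + 1)) - Fin.init w (Fin.natAdd (B + 1) (0 : Fin 1))) ^ 2) U'.domain)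
    (hs : u.1 (Fin.last B) ≠ 0)
    (hABset : (A = ((Fin.snoc (fun i : Fin B => -u.1 (Fin.castSucc i) / u.1 (Fin.last B))
        (-1 / u.1 (Fin.last B)) : Fin (B + 1) → ℚ), -u.2 / u.1 (Fin.last B)) ∧
        Bf = ((Fin.snoc ℓ₂.1 0 : Fin (B + 1) → ℚ), ℓ₂.2)) ∨
      (A = ((Fin.snoc ℓ₂.1 0 : Fin (B + 1) → ℚ), ℓ₂.2) ∧
        Bf = ((Fin.snoc (fun i : Fin B => -u.1 (Fin.castSucc i) / u.1 (Fin.last B))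
        (-1 / u.1 (Fin.last B)) : Fin (B + 1) → ℚ), -u.2 / u.1 (Fin.last B))))
    (hbdO : Bornology.IsBounded (gDom B 1 m₃ M₃ (fun _ => Sum.inr A) (fun _ => Sum.inr Bf)))
    (hlegO : (∀ w : Fin (B + 1 + 1) → ℝ, (∀ j, 0 < affF B 1 (M₃ j) w) → affF B 1 Bf w ≤ affB B 1 ylo w) ∨
      (∀ w : Fin (B + 1 + 1) → ℝ, (∀ j, 0 < affF B 1 (M₃ j) w) → affB B 1 yhi w ≤ affF B 1 A w))
    (hη : ∃ η : ℝ, 0 < η ∧ ∀ w : Fin (B + 1 + 1) → ℝ, (∀ j, 0 < affF B 1 (M₃ j) w) →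
      η ≤ affB B 1 yhi w - affB B 1 ylo w) :
    ∃ c ∈ AddSubgroup.closure (GGset B 2 1), KZ.of U' - c ∈ KZ.relations := by
  -- local abbreviations
  set sR : ℝ := (u.1 (Fin.last B) : ℝ) with hsR
  have hs' : sR ≠ 0 := by rw [hsR]; exact_mod_cast hs
  set τ' := gDom B 1 m₃ M₃ (fun _ => Sum.inr A) (fun _ => Sum.inr Bf) with hτ'
  have hτ'sa : IsSemialgebraic ℚ τ' := isSemialgebraic_gDom m₃ M₃ _ _
  set G : (Fin (B + 1 + 1) → ℝ) → ℝ := fun q =>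
    MvPolynomial.aeval (fun i => q (Fin.castAdd 1 (Fin.castSucc i))) p₃ / ∏ j, (affB B 1 (L j) q) ^ e j with hG
  set c : (Fin (B + 1 + 1) → ℝ) → ℝ := fun w => G w / sR / (affF B 1 Bf w - affF B 1 A w) with hc
  set σv : (Fin (B + 1 + 1) → ℝ) → ℝ := fun w => w (Fin.natAdd (B + 1) 0) with hσv
  set a' : (Fin (B + 1 + 1) → ℝ) → ℝ := fun w => affB B 1 ylo w with ha'
  set b' : (Fin (B + 1 + 1) → ℝ) → ℝ := fun w => affB B 1 yhi w with hb'
  set f' : (Fin (B + 1 + 1 + 1) → ℝ) → ℝ := fun w =>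
    c (Fin.init w) / (w (Fin.last (B + 1 + 1)) - σv (Fin.init w)) ^ 2 with hf'
  set F' : (Fin (B + 1 + 1 + 1) → ℝ) → ℝ := fun w =>
    -(c (Fin.init w) / (w (Fin.last (B + 1 + 1)) - σv (Fin.init w))) with hF'
  obtain ⟨η, hη0, hη⟩ := hη
  -- (1) facts on the output literal domain
  have hmem : ∀ w, w ∈ τ' ↔ (∀ j, 0 < affF B 1 (M₃ j) w) ∧ affF B 1 A w < σv w ∧ σv w < affF B 1 Bf w :=
    fun w => mem_gDom_one M₃ A Bf w
  have hwid : ∀ w ∈ τ', η ≤ b' w - a' w := fun w hw => hη w ((hmem w).1 hw).1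
  have hlt : ∀ w ∈ τ', a' w < b' w := fun w hw => by have := hwid w hw; linarith
  have hne : ∀ w ∈ τ', ∀ y ∈ Icc (a' w) (b' w), y - σv w ≠ 0 := by
    intro w hw y hy
    obtain ⟨hrow, h1, h2⟩ := (hmem w).1 hw
    simp only [ha', hb'] at hy
    rcases hlegO with h | h
    · have := h w hrow; intro h0; linarith [hy.1]
    · have := h w hrow; intro h0; linarith [hy.2]
  have hABτ : ∀ w ∈ τ', 0 < affF B 1 Bf w - affF B 1 A w := fun w hw => by
    obtain ⟨-, h1, h2⟩ := (hmem w).1 hw; linarith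
  -- (2) semialgebraicity
  have ha'S : IsSemialgebraicFunOn ℚ τ' a' := isSemialgebraicFunOn_affB' ylo hτ'sa
  have hb'S : IsSemialgebraicFunOn ℚ τ' b' := isSemialgebraicFunOn_affB' yhi hτ'sa
  have hσS : IsSemialgebraicFunOn ℚ τ' σv := isSemialgebraicFunOn_apply hτ'sa _
  have hGS : IsSemialgebraicFunOn ℚ τ' G := isSemialgebraicFunOn_ratX L e p₃ hτ'sa
  have hcS : IsSemialgebraicFunOn ℚ τ' c :=
    isSemialgebraicFunOn_div (isSemialgebraicFunOn_div hGS (isSemialgebraicFunOn_ratCast hτ'sa (u.1 (Fin.last B))))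
      (IsSemialgebraicFunOn.sub_holds (isSemialgebraicFunOn_affF' Bf hτ'sa) (isSemialgebraicFunOn_affF' A hτ'sa))
  have hBsa : IsSemialgebraic ℚ (KZlog.band τ' a' b') := KZlog.isSemialgebraic_band ha'S hb'S
  have hsub : KZlog.band τ' a' b' ⊆ {v | Fin.init v ∈ τ'} := fun v hv => hv.1
  have lift : ∀ {φ : (Fin (B + 1 + 1) → ℝ) → ℝ}, IsSemialgebraicFunOn ℚ τ' φ →
      IsSemialgebraicFunOn ℚ (KZlog.band τ' a' b') (fun v => φ (Fin.init v)) := fun h =>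
    h.comp_init.mono hsub hBsa
  have hlastS : IsSemialgebraicFunOn ℚ (KZlog.band τ' a' b') (fun v => v (Fin.last (B + 1 + 1))) :=
    isSemialgebraicFunOn_apply hBsa _
  have hlinS : IsSemialgebraicFunOn ℚ (KZlog.band τ' a' b') (fun v => v (Fin.last (B + 1 + 1)) - σv (Fin.init v)) :=
    IsSemialgebraicFunOn.sub_holds hlastS (lift hσS)
  have hf'S : IsSemialgebraicFunOn ℚ (KZlog.band τ' a' b') f' :=
    isSemialgebraicFunOn_div (lift hcS) (isSemialgebraicFunOn_pow hlinS 2)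
  have hF'S : IsSemialgebraicFunOn ℚ (KZlog.band τ' a' b') F' := (isSemialgebraicFunOn_div (lift hcS) hlinS).neg
  -- (3) fibrewise calculus
  have hfibF : ∀ w, (fun y => F' (Fin.snoc w y)) = fun y => -(c w / (y - σv w)) := fun w => by
    funext y; simp only [hF', Fin.init_snoc, Fin.snoc_last]
  have hfval : ∀ w y, f' (Fin.snoc w y) = c w / (y - σv w) ^ 2 := fun w y => by
    simp only [hf', Fin.init_snoc, Fin.snoc_last]
  have hderiv : ∀ (C σ y : ℝ), y - σ ≠ 0 → HasDerivAt (fun s : ℝ => -(C / (s - σ))) (C / (y - σ) ^ 2) y := by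
    intro C σ y hyσ
    have h1 : HasDerivAt (fun s : ℝ => s - σ) 1 y := (hasDerivAt_id' y).sub_const σ
    have h2 : HasDerivAt (fun s : ℝ => (s - σ)⁻¹) (-1 / (y - σ) ^ 2) y := h1.inv hyσ
    have h3 := (h2.const_mul C).fun_neg
    have h4 : -(C * (-1 / (y - σ) ^ 2)) = C / (y - σ) ^ 2 := by ring
    rw [h4] at h3
    have hfun : (fun s : ℝ => -(C / (s - σ))) = fun s => -(C * (s - σ)⁻¹) :=
      funext fun s => by rw [div_eq_mul_inv]
    rw [hfun]
    exact h3
  have hcont : ∀ w ∈ τ', ContinuousOn (fun y => F' (Fin.snoc w y)) (Icc (a' w) (b' w)) := by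
    intro w hw
    rw [hfibF]
    exact (continuousOn_const.div (continuousOn_id.sub continuousOn_const) (hne w hw)).neg
  have hder : ∀ w ∈ τ', ∀ y ∈ Ioo (a' w) (b' w),
      HasDerivAt (fun s => F' (Fin.snoc w s)) (f' (Fin.snoc w y)) y := by
    intro w hw y hy
    rw [hfibF, hfval]
    exact hderiv _ _ _ (hne w hw y (Ioo_subset_Icc_self hy))
  -- (4) EXCHANGE: integrate `y` out
  obtain ⟨V, hVd, hVi, hVrel⟩ := newtonLeibniz_pack hτ'sa ha'S hb'S hlt hf'S hF'S hcont hder U' hU'd hU'i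
  have hVint : ∀ w, V.integrand w = c w / (a' w - σv w) - c w / (b' w - σv w) := by
    intro w; rw [hVi]; simp only [hF', Fin.init_snoc, Fin.snoc_last]; ring
  -- (5) bounds on the output domain
  obtain ⟨R, hR0, hR⟩ := hbdO.exists_pos_norm_le
  have hcoord : ∀ w ∈ τ', ∀ i, |w i| ≤ R := fun w hw i => by
    have h := norm_le_pi_norm w i
    rw [Real.norm_eq_abs] at h
    exact h.trans (hR w hw)
  set Rhi : ℝ := (∑ i, |(yhi.1 i : ℝ)|) * R + |(yhi.2 : ℝ)| with hRhi
  set Rlo : ℝ := (∑ i, |(ylo.1 i : ℝ)|) * R + |(ylo.2 : ℝ)| with hRlo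
  have hbhi : ∀ w ∈ τ', |b' w| ≤ Rhi := fun w hw => abs_affB_le yhi fun i => hcoord w hw _
  have hblo : ∀ w ∈ τ', |a' w| ≤ Rlo := fun w hw => abs_affB_le ylo fun i => hcoord w hw _
  have hσb : ∀ w ∈ τ', |σv w| ≤ R := fun w hw => hcoord w hw _
  -- (6) SPLIT by two bounded multipliers
  set g₁ : (Fin (B + 1 + 1) → ℝ) → ℝ := fun w => (b' w - σv w) / (b' w - a' w) with hg₁
  set g₂ : (Fin (B + 1 + 1) → ℝ) → ℝ := fun w => (σv w - a' w) / (b' w - a' w) with hg₂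
  have hg₁S : IsSemialgebraicFunOn ℚ V.domain g₁ := by
    rw [hVd]
    exact isSemialgebraicFunOn_div (IsSemialgebraicFunOn.sub_holds hb'S hσS) (IsSemialgebraicFunOn.sub_holds hb'S ha'S)
  have hg₂S : IsSemialgebraicFunOn ℚ V.domain g₂ := by
    rw [hVd]
    exact isSemialgebraicFunOn_div (IsSemialgebraicFunOn.sub_holds hσS ha'S) (IsSemialgebraicFunOn.sub_holds hb'S ha'S)
  have hC₁ : ∀ w ∈ V.domain, |g₁ w| ≤ (Rhi + R) / η := by
    intro w hw
    rw [hVd] at hw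
    have hpos : 0 < b' w - a' w := lt_of_lt_of_le hη0 (hwid w hw)
    have hnum : |b' w - σv w| ≤ Rhi + R := (abs_sub _ _).trans (add_le_add (hbhi w hw) (hσb w hw))
    rw [hg₁]
    dsimp only
    rw [abs_div, abs_of_pos hpos]
    exact (div_le_div_of_nonneg_right hnum hpos.le).trans
      (div_le_div_of_nonneg_left ((abs_nonneg _).trans hnum) hη0 (hwid w hw))
  have hC₂ : ∀ w ∈ V.domain, |g₂ w| ≤ (R + Rlo) / η := by
    intro w hw
    rw [hVd] at hw
    have hpos : 0 < b' w - a' w := lt_of_lt_of_le hη0 (hwid w hw)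
    have hnum : |σv w - a' w| ≤ R + Rlo := (abs_sub _ _).trans (add_le_add (hσb w hw) (hblo w hw))
    rw [hg₂]
    dsimp only
    rw [abs_div, abs_of_pos hpos]
    exact (div_le_div_of_nonneg_right hnum hpos.le).trans
      (div_le_div_of_nonneg_left ((abs_nonneg _).trans hnum) hη0 (hwid w hw))
  set V₁ := mulRep V g₁ hg₁S _ hC₁ with hV₁
  set V₂ := mulRep V g₂ hg₂S _ hC₂ with hV₂
  have hsplit : KZ.of V - KZ.of V₁ - KZ.of V₂ ∈ KZ.relations := by
    refine KZ.integrandAddRel_subset_relations ⟨_, V, V₁, V₂, rfl, rfl, fun w hw => ?_, rfl⟩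
    rw [hVd] at hw
    have h0 : b' w - a' w ≠ 0 := (lt_of_lt_of_le hη0 (hwid w hw)).ne'
    show V.integrand w = V.integrand w * g₁ w + V.integrand w * g₂ w
    have h1 : g₁ w + g₂ w = 1 := by
      rw [hg₁, hg₂]
      dsimp only
      rw [← add_div, div_eq_one_iff_eq h0]
      ring
    rw [← mul_add, h1, mul_one]
  -- (7) the literal data of the two pieces
  set ℓ'' : (Fin B → ℚ) × ℚ := -restr B u - u.1 (Fin.last B) • ℓ₂ with hℓ''
  have hℓ''v : ∀ w : Fin (B + 1 + 1) → ℝ, affB B 1 ℓ'' w = -(affB B 1 (restr B u) w + sR * affB B 1 ℓ₂ w) :=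
    fun w => by rw [hℓ'', affB_sub, affB_neg', affB_smul', hsR]; ring
  set yloF : (Fin (B + 1) → ℚ) × ℚ := ((Fin.snoc ylo.1 0 : Fin (B + 1) → ℚ), ylo.2) with hyloF
  set yhiF : (Fin (B + 1) → ℚ) × ℚ := ((Fin.snoc yhi.1 0 : Fin (B + 1) → ℚ), yhi.2) with hyhiF
  have hylo0 : yloF.1 (Fin.last B) = 0 := by rw [hyloF]; simp
  have hyhi0 : yhiF.1 (Fin.last B) = 0 := by rw [hyhiF]; simp
  obtain ⟨ε, hε, hdiff, hslope⟩ : ∃ ε : ℚ, (ε = 1 ∨ ε = -1) ∧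
      (∀ w : Fin (B + 1 + 1) → ℝ, affF B 1 Bf w - affF B 1 A w =
        (ε : ℝ) * ((w (Fin.castAdd 1 (Fin.last B)) - affB B 1 ℓ'' w) / sR)) ∧
      (A.1 (Fin.last B) = 0 ∨ Bf.1 (Fin.last B) = 0) := by
    rcases hABset with ⟨hA, hB⟩ | ⟨hA, hB⟩
    · refine ⟨1, Or.inl rfl, fun w => ?_, Or.inr ?_⟩
      · rw [hA, hB, affF_liftB, affF_Tform, hℓ''v, ← hsR]
        push_cast
        field_simp
        ring
      · rw [hB]; simp
    · refine ⟨-1, Or.inr rfl, fun w => ?_, Or.inl ?_⟩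
      · rw [hA, hB, affF_liftB, affF_Tform, hℓ''v, ← hsR]
        push_cast
        field_simp
        ring
      · rw [hA]; simp
  have hε2 : (ε : ℝ) * ε = 1 := by rcases hε with rfl | rfl <;> norm_num
  have hε0 : (ε : ℝ) ≠ 0 := by rcases hε with rfl | rfl <;> norm_num
  have hX : ∀ w ∈ τ', w (Fin.castAdd 1 (Fin.last B)) - affB B 1 ℓ'' w ≠ 0 := by
    intro w hw h0
    have := hABτ w hw
    rw [hdiff w, h0, zero_div, mul_zero] at this
    exact lt_irrefl _ this
  have hcv : ∀ w ∈ τ', c w = (ε : ℝ) * G w / (w (Fin.castAdd 1 (Fin.last B)) - affB B 1 ℓ'' w) := by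
    intro w hw
    have hXw := hX w hw
    rw [hc]
    dsimp only
    rw [hdiff w]
    calc G w / sR / ((ε : ℝ) * ((w (Fin.castAdd 1 (Fin.last B)) - affB B 1 ℓ'' w) / sR))
        = G w / ((ε : ℝ) * (w (Fin.castAdd 1 (Fin.last B)) - affB B 1 ℓ'' w)) := by
          field_simp
      _ = (ε : ℝ) * ε * G w / ((ε : ℝ) * (w (Fin.castAdd 1 (Fin.last B)) - affB B 1 ℓ'' w)) := by
          rw [hε2, one_mul]
      _ = (ε : ℝ) * G w / (w (Fin.castAdd 1 (Fin.last B)) - affB B 1 ℓ'' w) := by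
          field_simp
  have hGw : ∀ w : Fin (B + 1 + 1) → ℝ,
      MvPolynomial.aeval (fun i => w (Fin.castAdd 1 (Fin.castSucc i))) p₃ / ∏ j, (affB B 1 (L j) w) ^ e j = G w :=
    fun w => rfl
  have hV₁i : EqOn V₁.integrand (glit B 1 (MvPolynomial.C (-ε) * p₃) L e ℓ'' ℓ'' 0 1 (fun _ => some yloF)) V₁.domain := by
    intro w hw
    have hw' : w ∈ τ' := by rw [← hVd]; exact hw
    have h0 : affB B 1 yhi w - affB B 1 ylo w ≠ 0 := (lt_of_lt_of_le hη0 (hwid w hw')).ne'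
    have ha0 : affB B 1 ylo w - w (Fin.natAdd (B + 1) 0) ≠ 0 := hne w hw' (a' w) (left_mem_Icc.2 (hlt w hw').le)
    have hb0 : affB B 1 yhi w - w (Fin.natAdd (B + 1) 0) ≠ 0 := hne w hw' (b' w) (right_mem_Icc.2 (hlt w hw').le)
    have ha0' : w (Fin.natAdd (B + 1) 0) - affB B 1 ylo w ≠ 0 := fun h => ha0 (by linarith)
    have hb0' : w (Fin.natAdd (B + 1) 0) - affB B 1 yhi w ≠ 0 := fun h => hb0 (by linarith)
    have hXw := hX w hw'
    show V.integrand w * g₁ w = _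
    rw [hVint w, glit_one, pow_zero, pow_one, map_mul, MvPolynomial.aeval_C, eq_ratCast, mul_div_assoc, hGw,
      hcv w hw', hyloF, affF_liftB, hg₁]
    simp only [ha', hb', hσv]
    push_cast
    field_simp
    ring
  have hV₂i : EqOn V₂.integrand (glit B 1 (MvPolynomial.C ε * p₃) L e ℓ'' ℓ'' 0 1 (fun _ => some yhiF)) V₂.domain := by
    intro w hw
    have hw' : w ∈ τ' := by rw [← hVd]; exact hw
    have h0 : affB B 1 yhi w - affB B 1 ylo w ≠ 0 := (lt_of_lt_of_le hη0 (hwid w hw')).ne'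
    have ha0 : affB B 1 ylo w - w (Fin.natAdd (B + 1) 0) ≠ 0 := hne w hw' (a' w) (left_mem_Icc.2 (hlt w hw').le)
    have hb0 : affB B 1 yhi w - w (Fin.natAdd (B + 1) 0) ≠ 0 := hne w hw' (b' w) (right_mem_Icc.2 (hlt w hw').le)
    have ha0' : w (Fin.natAdd (B + 1) 0) - affB B 1 ylo w ≠ 0 := fun h => ha0 (by linarith)
    have hb0' : w (Fin.natAdd (B + 1) 0) - affB B 1 yhi w ≠ 0 := fun h => hb0 (by linarith)
    have hXw := hX w hw'
    show V.integrand w * g₂ w = _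
    rw [hVint w, glit_one, pow_zero, pow_one, map_mul, MvPolynomial.aeval_C, eq_ratCast, mul_div_assoc, hGw,
      hcv w hw', hyhiF, affF_liftB, hg₂]
    simp only [ha', hb', hσv]
    field_simp
    ring
  -- (8) PRODUCT: both pieces land in `GG B 2 1`
  have hd₁ : V₁.domain = gDom B 1 m₃ M₃ (fun _ => Sum.inr A) (fun _ => Sum.inr Bf) := hVd
  have hd₂ : V₂.domain = gDom B 1 m₃ M₃ (fun _ => Sum.inr A) (fun _ => Sum.inr Bf) := hVd
  have hbd₁ : Bornology.IsBounded V₁.domain := by rw [hd₁]; exact hbdO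
  have hbd₂ : Bornology.IsBounded V₂.domain := by rw [hd₂]; exact hbdO
  have hsl : ∀ cF : (Fin (B + 1) → ℚ) × ℚ, cF.1 (Fin.last B) = 0 → ∀ (i : Fin 1) (c : (Fin (B + 1) → ℚ) × ℚ),
      (fun _ : Fin 1 => some cF) i = some c →
      ((fun _ : Fin 1 => A) i).1 (Fin.last B) = c.1 (Fin.last B) ∨ ((fun _ : Fin 1 => Bf) i).1 (Fin.last B) = c.1 (Fin.last B) := by
    intro cF hcF i c hc
    simp only [Option.some.injEq] at hc
    subst hc
    rw [hcF]
    exact hslope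
  obtain ⟨c₁, hc₁m, hc₁r⟩ := good_product (fun _ => some yloF) (fun _ => A) (fun _ => Bf) V₁ M₃ L e
    (MvPolynomial.C (-ε) * p₃) ℓ'' ℓ'' (fun _ => Sum.inr A) (fun _ => Sum.inr Bf) (Or.inl rfl) hbd₁ hd₁ hV₁i
    (fun _ => rfl) (fun _ => rfl) (hsl yloF hylo0)
  obtain ⟨c₂, hc₂m, hc₂r⟩ := good_product (fun _ => some yhiF) (fun _ => A) (fun _ => Bf) V₂ M₃ L e
    (MvPolynomial.C ε * p₃) ℓ'' ℓ'' (fun _ => Sum.inr A) (fun _ => Sum.inr Bf) (Or.inl rfl) hbd₂ hd₂ hV₂i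
    (fun _ => rfl) (fun _ => rfl) (hsl yhiF hyhi0)
  refine ⟨c₁ + c₂, add_mem hc₁m hc₂m, ?_⟩
  have : KZ.of U' - (c₁ + c₂) =
      (KZ.of U' - KZ.of V) + (KZ.of V - KZ.of V₁ - KZ.of V₂) + (KZ.of V₁ - c₁) + (KZ.of V₂ - c₂) := by abel
  rw [this]
  exact add_mem (add_mem (add_mem hVrel hsplit) hc₁r) hc₂r

end ExchangeSplit

end RebasePos

/-- **Registered support goal of this file: EXCHANGE + SPLIT + PRODUCT**
(`RebasePos.exchange_split`). The unfolded-and-cycled thin band `U'` (output of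
`rebaseSimplePos_unfoldCycle`) over a NON-PINCHING `y`-range is congruent modulo `KZ.relations`
to the subgroup generated by the literal class `GG B 2 1`: integrate `y` out (rule 3), split the
two `σ`-letters by bounded multipliers (rule 1b), land both pieces by `RebasePos.good_product`
(rule 2). -/
theorem rebaseSimplePos_exchangeSplit (B m m₃ : ℕ) (L : Fin m → (Fin B → ℚ) × ℚ) (e : Fin m → ℕ) (p₃ : MvPolynomial (Fin B) ℚ) (ℓ₂ : (Fin B → ℚ) × ℚ) (u : (Fin (B + 1) → ℚ) × ℚ) (M₃ : Fin m₃ → (Fin (B + 1) → ℚ) × ℚ) (A Bf : (Fin (B + 1) → ℚ) × ℚ) (ylo yhi : (Fin B → ℚ) × ℚ) (U' : KZ.IntegralRep (B + 1 + 1 + 1)) (hU'd : U'.domain = {w | (Fin.init w : Fin (B + 1 + 1) → ℝ) ∈ SeparatePos.gDom B 1 m₃ M₃ (fun _ => Sum.inr A) (fun _ => Sum.inr Bf) ∧ SeparatePos.affB B 1 ylo (Fin.init w) < w (Fin.last (B + 1 + 1)) ∧ w (Fin.last (B + 1 + 1)) < SeparatePos.affB B 1 yhi (Fin.init w)}) (hU'i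 : Set.EqOn U'.integrand (fun w => MvPolynomial.aeval (fun i => Fin.init w (Fin.castAdd 1 (Fin.castSucc i))) p₃ / (∏ j, (SeparatePos.affB B 1 (L j) (Fin.init w)) ^ e j) / (u.1 (Fin.last B) : ℝ) / (SeparatePos.affF B 1 Bf (Fin.init w) - SeparatePos.affF B 1 A (Fin.init w)) / (w (Fin.last (B + 1 + 1)) - Fin.init w (Fin.natAdd (B + 1) (0 : Fin 1))) ^ 2) U'.domain) (hs : u.1 (Fin.last B) ≠ 0) (hABset : (A = ((Fin.snoc (fun i : Fin B => -u.1 (Fin.castSucc i) / u.1 (Fin.last B)) (-1 / u.1 (Fin.last B)) : Fin (B + 1) → ℚ), -u.2 / u.1 (Fin.last B)) ∧ Bf = ((Fin.snoc ℓ₂.1 0 : Fin (B + 1) → ℚ), ℓ₂.2)) ∨ (A = ((Fin.snoc ℓ₂.1 0 : Fin (B + 1) → ℚ), ℓ₂.2) ∧ Bf = ((Fin.snoc (fun i : Fin B => -u.1 (Fin.castSucc i) / u.1 (Fin.last B)) (-1 / u.1 (Fin.last B)) : Fin (B + 1) → ℚ), -u.2 / u.1 (Fin.last B)))) (hbdO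 : Bornology.IsBounded (SeparatePos.gDom B 1 m₃ M₃ (fun _ => Sum.inr A) (fun _ => Sum.inr Bf))) (hlegO : (∀ w : Fin (B + 1 + 1) → ℝ, (∀ j, 0 < SeparatePos.affF B 1 (M₃ j) w) → SeparatePos.affF B 1 Bf w ≤ SeparatePos.affB B 1 ylo w) ∨ (∀ w : Fin (B + 1 + 1) → ℝ, (∀ j, 0 < SeparatePos.affF B 1 (M₃ j) w) → SeparatePos.affB B 1 yhi w ≤ SeparatePos.affF B 1 A w)) (hη : ∃ η : ℝ, 0 < η ∧ ∀ w : Fin (B + 1 + 1) → ℝ, (∀ j, 0 < SeparatePos.affF B 1 (M₃ j) w) → η ≤ SeparatePos.affB B 1 yhi w - SeparatePos.affB B 1 ylo w) : ∃ c ∈ AddSubgroup.closure (SeparatePos.GGset B 2 1), KZ.of U' - c ∈ KZ.relations :=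
  RebasePos.exchange_split L e p₃ ℓ₂ u M₃ A Bf ylo yhi U' hU'd hU'i hs hABset hbdO hlegO hη

end Summit.KontsevichZagierPeriods.ArrangementNormalForm.JanusBands
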